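import Mathlib.RingTheory.Valuation.ValuationSubring
import Mathlib.RingTheory.LocalRing.ResidueField.Basic
import Mathlib.FieldTheory.KummerPolynomial
import Mathlib.FieldTheory.Minpoly.Field
import Mathlib.Algebra.CharP.Lemmas
import Mathlib.Algebra.CharP.Algebra
import Mathlib.Algebra.Polynomial.Degree.SmallDegree
import HarnessLib

/-!
# The sharp relation forces `z^{1/p}` into every residue field

Line `birth` of crux `SharpStrata.SepExcModels` (stmt-ResolutionOfSingularities-16828,
`Cruxes/SepExcModels/Lines/birth.lean`), lead c1, tool stub (N1)
`stub_residue_pthPower_of_sharpRelation`, PROVED: the valuation-theoretic heart of the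
sharpness certificate for the normal threefold `t^p = z x^p + z² y^p + x^{p+1} + y^{p+1}`
(`p ≥ 3`), which is sharp along the `z`-axis (Benito–Piltant–Reguera 2022, Question 6.6 and the
method of their Example 6.3).

Setting: `L` a field of characteristic `p ≥ 3`, `O` a valuation ring of `L` with valuation `v`
and residue field `κ = O ⧸ 𝔪_O`, and elements `z ∈ O`, `x, y, t, e₁, e₂ ∈ L` with
`t^p = z x^p + z² y^p + e₁ x^p + e₂ y^p`, `x, y ≠ 0` and `v(e₁), v(e₂) < 1`. Conclusion
(`stub_residue_pthPower_of_sharpRelation`): the residue `z̄ ∈ κ` of `z` is a `p`-th power.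

## Proof

Let `d ∈ {x, y}` be the element of larger value, so that `a = x/d`, `b = y/d` lie in `O` and one
of them is `1`. Dividing the relation by `d^p` gives
`(t/d)^p = z a^p + z² b^p + e₁ a^p + e₂ b^p ∈ O`, hence `t/d ∈ O`, and in `κ` (where
`ē₁ = ē₂ = 0`): `μ^p = z̄ ā^p + z̄² b̄^p` with `(ā, b̄) ≠ (0, 0)`
(`residue_pthPower_of_sharpRelation_aux`). The purely field-theoretic statement
`exists_pow_eq_of_sharpRelation` finishes: in a field `κ` of characteristic `p ≥ 3`,
`μ^p = ζ α^p + ζ² β^p` with `(α, β) ≠ (0, 0)` forces `ζ ∈ κ^p`. Indeed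

* if `α = 0` then `(μ/β)^p = ζ²`, and `ζ = ((μ/β)^{(p+1)/2} / ζ)^p` (`p` odd; or `ζ = 0`)
  (`exists_pow_eq_of_pow_eq_sq`);
* if `α ≠ 0` then `c^p = ζ + ζ² γ^p` with `c = μ/α`, `γ = β/α`
  (`exists_pow_eq_of_pow_eq_add_sq_mul_pow`): if `γ = 0` we are done; otherwise, were `ζ` not a
  `p`-th power, `X^p − ζ` would be irreducible (Mathlib's `X_pow_sub_C_irreducible_of_prime`), and
  in the field `E = κ[X]/(X^p − ζ)` with `w = X̄`, `w^p = ζ`, Frobenius gives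
  `(w + w² γ − c)^p = ζ + ζ² γ^p − c^p = 0`, so `w` is a root of `γ T² + T − c ∈ κ[T]`, a nonzero
  polynomial of degree `2 < p = deg (X^p − ζ) = deg minpoly_κ(w)` — impossible.

The hypotheses `v(x) < 1`, `v(y) < 1` of the registered signature are not needed for the
conclusion and are not used.

## Sources

* A. Benito, O. Piltant, A. J. Reguera, *Small irreducible components of arc spaces in positive
  characteristic*, J. Pure Appl. Algebra 226 (2022), Question 6.6, Example 6.3 (method).
  [BenitoPiltantReguera2022]
-/

noncomputable section

-- single-problem summit: the doubled namespace component `ResolutionOfSingularities` is forced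
set_option linter.dupNamespace false

open IsLocalRing Polynomial

namespace Summit.ResolutionOfSingularities.ResolutionOfSingularities.Theorems.SepExcModels.SharpRelation

/-! ## Field theory: `p`-th roots forced by the sharp relation -/

/-- **`σ^p = ζ²` with `p` odd makes `ζ` a `p`-th power** (in any field): `ζ = 0 = 0^p`, or
`ζ = (σ^{m+1} / ζ)^p` for `p = 2m + 1`, since `σ^{p(m+1)} = ζ^{2m+2} = ζ · ζ^p`. [folklore] -/
theorem exists_pow_eq_of_pow_eq_sq {κ : Type*} [Field κ] {p : ℕ} (hodd : Odd p) (σ ζ : κ)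
    (h : σ ^ p = ζ ^ 2) : ∃ w : κ, w ^ p = ζ := by
  obtain ⟨m, rfl⟩ := hodd
  by_cases hζ : ζ = 0
  · exact ⟨0, by rw [hζ]; exact zero_pow (Nat.succ_ne_zero _)⟩
  refine ⟨σ ^ (m + 1) / ζ, ?_⟩
  rw [div_pow, ← pow_mul, mul_comm (m + 1), pow_mul, h, ← pow_mul,
    div_eq_iff (pow_ne_zero _ hζ)]
  ring

/-- **`c^p = ζ + ζ² β^p` in characteristic `p ≥ 3` makes `ζ` a `p`-th power.** If `β = 0` take
`c`. Otherwise, if `ζ` were not a `p`-th power, `X^p − ζ` would be irreducible over `κ`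
(`X_pow_sub_C_irreducible_of_prime`); in `E = κ[X]/(X^p − ζ)` the class `w` of `X` has `w^p = ζ`
and, by Frobenius, `(w + w² β − c)^p = ζ + ζ² β^p − c^p = 0`, so `w + w² β − c = 0`: `w` is a root
of the nonzero polynomial `β T² + T − c` of degree `≤ 2`, which the minimal polynomial
`X^p − ζ` of `w` (degree `p ≥ 3`) would have to divide — a contradiction.
[cite: BenitoPiltantReguera2022, Example 6.3 (method)] -/
theorem exists_pow_eq_of_pow_eq_add_sq_mul_pow {κ : Type*} [Field κ] (p : ℕ) [hp : Fact p.Prime]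
    [CharP κ p] (hp3 : 3 ≤ p) (ζ β c : κ) (h : c ^ p = ζ + ζ ^ 2 * β ^ p) :
    ∃ w : κ, w ^ p = ζ := by
  have hp0 : p ≠ 0 := hp.out.ne_zero
  by_cases hβ : β = 0
  · exact ⟨c, by rw [h, hβ, zero_pow hp0, mul_zero, add_zero]⟩
  by_cases hex : ∃ w : κ, w ^ p = ζ
  · exact hex
  have hno : ∀ w : κ, w ^ p ≠ ζ := fun w hw => hex ⟨w, hw⟩
  exfalso
  haveI hirr : Fact (Irreducible (X ^ p - C ζ)) := ⟨X_pow_sub_C_irreducible_of_prime hp.out hno⟩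
  haveI : CharP (AdjoinRoot (X ^ p - C ζ)) p :=
    charP_of_injective_algebraMap (algebraMap κ (AdjoinRoot (X ^ p - C ζ))).injective p
  -- `w`, a `p`-th root of `ζ` in the field `E = κ[X]/(X^p - ζ)`
  have hw := root_X_pow_sub_C_pow p ζ
  rw [← AdjoinRoot.algebraMap_eq] at hw
  generalize AdjoinRoot.root (X ^ p - C ζ) = w at hw
  -- Frobenius: `(w + w² β - c)^p = 0`, so `w` is a root of `β T² + T - c`
  have hfrob : (w + w ^ 2 * algebraMap κ _ β - algebraMap κ _ c) ^ p = 0 := by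
    rw [sub_pow_char, sub_eq_zero, add_pow_char, mul_pow, ← pow_mul, mul_comm 2 p, pow_mul, hw,
      ← map_pow, ← map_pow, ← map_pow, h, map_add, map_mul]
  have hroot : w + w ^ 2 * algebraMap κ _ β - algebraMap κ _ c = 0 := (pow_eq_zero_iff hp0).mp hfrob
  have haeval : aeval w (C β * X ^ 2 + C 1 * X + C (-c)) = 0 := by
    rw [← hroot]
    simp only [map_add, map_mul, map_neg, map_one, aeval_C, aeval_X_pow, aeval_X]
    ring
  -- `X^p - ζ` is the minimal polynomial of `w`, hence divides `β T² + T - c ≠ 0`: degrees clash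
  have hmin : X ^ p - C ζ = minpoly κ w :=
    minpoly.eq_of_irreducible_of_monic hirr.out
      (by rw [map_sub, aeval_X_pow, aeval_C, hw, sub_self]) (monic_X_pow_sub_C ζ hp0)
  have hdvd : X ^ p - C ζ ∣ C β * X ^ 2 + C 1 * X + C (-c) := hmin ▸ minpoly.dvd κ w haeval
  have hne : C β * X ^ 2 + C 1 * X + C (-c) ≠ 0 := fun h0 =>
    hβ (by rw [← leadingCoeff_quadratic (b := (1 : κ)) (c := -c) hβ, h0, leadingCoeff_zero])
  have h1 := natDegree_le_of_dvd hdvd hne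
  rw [natDegree_X_pow_sub_C] at h1
  have h2 : (C β * X ^ 2 + C 1 * X + C (-c)).natDegree ≤ 2 := natDegree_quadratic_le
  omega

/-- **The sharp relation in a field of characteristic `p ≥ 3`:** if
`μ^p = ζ α^p + ζ² β^p` with `(α, β) ≠ (0, 0)`, then `ζ` is a `p`-th power. If `α ≠ 0`, divide by
`α^p` and use `exists_pow_eq_of_pow_eq_add_sq_mul_pow`; if `α = 0`, then `(μ/β)^p = ζ²` and
`exists_pow_eq_of_pow_eq_sq` applies (`p` is odd).
[cite: BenitoPiltantReguera2022, Example 6.3 (method)] -/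
theorem exists_pow_eq_of_sharpRelation {κ : Type*} [Field κ] (p : ℕ) [hp : Fact p.Prime]
    [CharP κ p] (hp3 : 3 ≤ p) (ζ α β μ : κ) (h : μ ^ p = ζ * α ^ p + ζ ^ 2 * β ^ p)
    (hαβ : α ≠ 0 ∨ β ≠ 0) : ∃ w : κ, w ^ p = ζ := by
  have hp0 : p ≠ 0 := hp.out.ne_zero
  by_cases hα : α = 0
  · have hβ : β ≠ 0 := hαβ.resolve_left (not_not.mpr hα)
    refine exists_pow_eq_of_pow_eq_sq (hp.out.odd_of_ne_two (by omega)) (μ / β) ζ ?_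
    rw [div_pow, h, hα, zero_pow hp0, mul_zero, zero_add,
      mul_div_cancel_right₀ _ (pow_ne_zero _ hβ)]
  · refine exists_pow_eq_of_pow_eq_add_sq_mul_pow p hp3 ζ (β / α) (μ / α) ?_
    rw [div_pow, div_pow, h, add_div, mul_div_cancel_right₀ _ (pow_ne_zero _ hα), mul_div_assoc]

/-! ## Valuation rings: reduction of the sharp relation to the residue field -/

/-- **The residue field of a valuation ring of a field of characteristic `p` has characteristic
`p`** (`p` prime): `p = 0` in `L`, hence in `O ⊆ L`, hence in `O ⧸ 𝔪_O`. [folklore] -/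
theorem charP_residueField {L : Type*} [Field L] (p : ℕ) [hp : Fact p.Prime] [CharP L p]
    (O : ValuationSubring L) : CharP (ResidueField O) p := by
  rw [CharP.charP_iff_prime_eq_zero hp.out]
  have h : (p : O) = 0 := Subtype.ext (by push_cast; exact CharP.cast_eq_zero L p)
  rw [← map_natCast (residue O), h, map_zero]

/-- **Reduction step.** Let `O` be a valuation ring of a field `L` of characteristic `p ≥ 3`,
`z, e₁, e₂, a, b ∈ O` with `e₁, e₂ ∈ 𝔪_O` and `a` or `b` a unit, and `t, d ∈ L`, `d ≠ 0`, with
`t^p = (z a^p + z² b^p + e₁ a^p + e₂ b^p) · d^p`. Then `z̄` is a `p`-th power in the residue field: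
`(t/d)^p ∈ O` forces `t/d ∈ O` (`v((t/d)^p) = v(t/d)^p ≤ 1`), and reducing modulo `𝔪_O` gives
`μ^p = z̄ ā^p + z̄² b̄^p` with `(ā, b̄) ≠ (0, 0)`, to which `exists_pow_eq_of_sharpRelation`
applies; a `p`-th root of `z̄` lifts to `O`.
[cite: BenitoPiltantReguera2022, Example 6.3 (method)] -/
theorem residue_pthPower_of_sharpRelation_aux {L : Type} [Field L] (p : ℕ) [hp : Fact p.Prime]
    [CharP L p] (hp3 : 3 ≤ p) (O : ValuationSubring L) (z e₁ e₂ a b : O) (t d : L) (hd0 : d ≠ 0)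
    (hrel : t ^ p = ((z * a ^ p + z ^ 2 * b ^ p + e₁ * a ^ p + e₂ * b ^ p : O) : L) * d ^ p)
    (he₁ : e₁ ∈ maximalIdeal O) (he₂ : e₂ ∈ maximalIdeal O) (hab : IsUnit a ∨ IsUnit b) :
    ∃ u : O, residue O u ^ p = residue O z := by
  have hp0 : p ≠ 0 := hp.out.ne_zero
  haveI := charP_residueField p O
  -- `μ = t / d` lies in `O`, with `μ^p = z a^p + z² b^p + e₁ a^p + e₂ b^p`
  have hμp : (t / d) ^ p = ((z * a ^ p + z ^ 2 * b ^ p + e₁ * a ^ p + e₂ * b ^ p : O) : L) := by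
    rw [div_pow, hrel, mul_div_cancel_right₀ _ (pow_ne_zero _ hd0)]
  have hμ : t / d ∈ O := by
    rw [← O.valuation_le_one_iff, ← pow_le_one_iff hp0, ← map_pow, hμp]
    exact O.valuation_le_one _
  have hrelO : (⟨t / d, hμ⟩ : O) ^ p = z * a ^ p + z ^ 2 * b ^ p + e₁ * a ^ p + e₂ * b ^ p :=
    Subtype.ext (by push_cast; exact hμp)
  -- reduce modulo `𝔪_O`
  have hres := congrArg (residue O) hrelO
  rw [map_pow, map_add, map_add, map_add, map_mul, map_mul, map_mul, map_mul, map_pow, map_pow,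
    map_pow, (residue_eq_zero_iff _).mpr he₁, (residue_eq_zero_iff _).mpr he₂, zero_mul, zero_mul,
    add_zero, add_zero] at hres
  have hab' : residue O a ≠ 0 ∨ residue O b ≠ 0 :=
    hab.imp (residue_ne_zero_iff_isUnit a).mpr (residue_ne_zero_iff_isUnit b).mpr
  obtain ⟨w, hw⟩ := exists_pow_eq_of_sharpRelation p hp3 _ _ _ _ hres hab'
  obtain ⟨u, rfl⟩ := residue_surjective w
  exact ⟨u, hw⟩

/-! ## The stub -/

/-- **STUB (N1) of line `birth`, PROVED: the sharp relation forces `z^{1/p}` into every residue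
field.** In a valued field `(L, O)` of characteristic `p ≥ 3`: if
`t^p = z x^p + z² y^p + e₁ x^p + e₂ y^p` with `x, y ≠ 0`, `z ∈ O` and `e₁, e₂` of value `< 1`,
then the residue of `z` is a `p`-th power in the residue field `O ⧸ 𝔪_O`. Proof: with `d` the
one of `x, y` of larger value, `x = a d`, `y = b d` with `a, b ∈ O` and `a = 1` or `b = 1`
(`ValuationSubring.valuation_le_iff`), and `t^p = (z a^p + z² b^p + e₁ a^p + e₂ b^p) d^p`;
conclude by `residue_pthPower_of_sharpRelation_aux`. The hypotheses `v(x) < 1`, `v(y) < 1` are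
part of the registered signature but are not needed.
[cite: BenitoPiltantReguera2022, Example 6.3 (method)] -/
theorem stub_residue_pthPower_of_sharpRelation {L : Type} [Field L] (p : ℕ) [Fact p.Prime]
    [CharP L p] (hp : 3 ≤ p) (z x y t e₁ e₂ : L)
    (hrel : t ^ p = z * x ^ p + z ^ 2 * y ^ p + e₁ * x ^ p + e₂ * y ^ p)
    (hx0 : x ≠ 0) (hy0 : y ≠ 0) (O : ValuationSubring L) (hzO : z ∈ O)
    (hx : O.valuation x < 1) (hy : O.valuation y < 1)
    (he₁ : O.valuation e₁ < 1) (he₂ : O.valuation e₂ < 1) :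
    ∃ u : O, IsLocalRing.residue O u ^ p = IsLocalRing.residue O ⟨z, hzO⟩ := by
  have _ := And.intro hx hy -- `hx`, `hy` (registered signature) are not needed below
  have he₁O : e₁ ∈ O := (O.valuation_le_one_iff e₁).mp he₁.le
  have he₂O : e₂ ∈ O := (O.valuation_le_one_iff e₂).mp he₂.le
  have he₁' : (⟨e₁, he₁O⟩ : O) ∈ maximalIdeal O := (O.valuation_lt_one_iff _).mpr he₁
  have he₂' : (⟨e₂, he₂O⟩ : O) ∈ maximalIdeal O := (O.valuation_lt_one_iff _).mpr he₂
  rcases le_total (O.valuation y) (O.valuation x) with hyx | hxy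
  · -- `d = x`, `a = 1`, `y = b x`
    obtain ⟨b, hb⟩ := (O.valuation_le_iff y x).mp hyx
    refine residue_pthPower_of_sharpRelation_aux p hp O ⟨z, hzO⟩ ⟨e₁, he₁O⟩ ⟨e₂, he₂O⟩ 1 b t x
      hx0 ?_ he₁' he₂' (Or.inl isUnit_one)
    rw [hrel, ← hb]; push_cast; ring
  · -- `d = y`, `b = 1`, `x = a y`
    obtain ⟨a, ha⟩ := (O.valuation_le_iff x y).mp hxy
    refine residue_pthPower_of_sharpRelation_aux p hp O ⟨z, hzO⟩ ⟨e₁, he₁O⟩ ⟨e₂, he₂O⟩ a 1 t y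
      hy0 ?_ he₁' he₂' (Or.inr isUnit_one)
    rw [hrel, ← ha]; push_cast; ring

end Summit.ResolutionOfSingularities.ResolutionOfSingularities.Theorems.SepExcModels.SharpRelation

end
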